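import Summits.NavierStokesRegularity.NavierStokesRegularity.Theorems.PerpetualPumpThesisUniquenessContinuity

/-!
# Stub G (`restart`) for `PerpetualPump.Thesis`: semigroup gluing of a restarted mild solution

Support file (stub `restart` of line `SketchIdeator2`, crux stmt-NavierStokesRegularity-1832). In
Tao's duality formulation of mild `H¹⁰_df` solutions (J. Amer. Math. Soc. 29 (2016),
arXiv:1402.0290v3, §1.1 (1.15)), `⟨u(t), w⟩ = ⟨e^{tΔ}a, w⟩ + ∫₀ᵗ ⟨B̃(u(s),u(s)), e^{(t-s)Δ} w⟩ ds`
for all `w ∈ H¹⁰_df`, let `u` be a mild solution from `a` on `[0,T)` and let `v` be a mild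
solution on `[0,τ]` from the restarted datum `u(t₁)`, `0 ≤ t₁ < T`. Then the concatenation
`t ↦ u(t)` (`t ≤ t₁`), `t ↦ v(t - t₁)` (`t > t₁`) is a mild solution from `a` on `[0, t₁ + τ)`
(`stub_restart`), for an ARBITRARY averaging datum `𝒜`. Pure bookkeeping:

* the heat semigroup law `e^{αΔ} e^{βΔ} = e^{(α+β)Δ}` (`heat_heat`) and the symmetry
  `⟨e^{τΔ}u, w⟩ = ⟨u, e^{τΔ}w⟩` (tree: `pairing_heat_left`);
* `v(0) = u(t₁)` (an identity in `(H¹⁰_df)*` between `H¹⁰_df` fields, `eq_of_forall_pairing_eq`);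
* `H¹⁰`-continuity of the concatenation (`continuousInH10On_glue`: left/right limits at the
  junction), hence interval integrability of the Duhamel integrand (part II of stub U,
  `U.intervalIntegrable_form_heat`);
* splitting the Duhamel integral at `t₁` (`intervalIntegral.integral_add_adjacent_intervals`) after
  the change of variables `σ ↦ σ - t₁` in `v`'s integral (`duhamel_glue`).

## References

* T. Tao, J. Amer. Math. Soc. 29 (2016), 601–674, arXiv:1402.0290v3, §1.1 (1.15).
-/

noncomputable section

open MeasureTheory Set Filter Topology
open scoped ENNReal NNReal

set_option linter.dupNamespace false

namespace Summit.NavierStokesRegularity.NavierStokesRegularity.Theorems.PerpetualPumpThesis.G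

open Literature.Analysis.FluidPDE Literature.Analysis.FluidPDE.Tao2016
open Literature.Analysis.FunctionSpaces (eFourierSobolevNorm)

/-! ### The heat semigroup law and identification of fields through the pairing -/

/-- **Semigroup law of the heat flow**: `e^{αΔ} (e^{βΔ} w) = e^{(α+β)Δ} w` for `α, β ≥ 0` (the heat
symbols multiply: `e^{-4π²α|ξ|²} e^{-4π²β|ξ|²} = e^{-4π²(α+β)|ξ|²}`). -/
theorem heat_heat {α β : ℝ} (hα : 0 ≤ α) (hβ : 0 ≤ β) (w : L2C) :
    heat α (heat β w) = heat (α + β) w := by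
  apply eq_of_fourierFn_ae_eq
  filter_upwards [fourierFn_heat α (heat β w), fourierFn_heat β w, fourierFn_heat (α + β) w]
    with ξ h1 h2 h3
  rw [h1, h2, h3, smul_smul]
  congr 1
  unfold heatSymbol
  rw [max_eq_left hα, max_eq_left hβ, max_eq_left (add_nonneg hα hβ), ← Complex.ofReal_mul,
    ← Real.exp_add]
  congr 2
  ring

/-- **Two `H¹⁰_df` fields with the same pairings against all of `H¹⁰_df` coincide** (their
difference is an admissible test field, and a real field orthogonal to itself vanishes). -/
theorem eq_of_forall_pairing_eq {x y : L2C} (hx : MemH10df x) (hy : MemH10df y)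
    (h : ∀ w, MemH10df w → pairing x w = pairing y w) : x = y := by
  have hw : MemH10df (x - y) := hx.sub hy
  have h0 : pairing (x - y) (x - y) = 0 := by
    rw [pairing_sub_left, h _ hw, sub_self]
  exact sub_eq_zero.1 (eq_zero_of_pairing_self_eq_zero hw.2.1 h0)

/-! ### The concatenated curve -/

section Glue

variable {F : L2C → L2C → L2C → ℂ} {a : L2C} {T t₁ τ : ℝ} {u v g : ℝ → L2C}

/-- **The restarted solution starts at the restart value**: `v(0) = u(t₁)` whenever `v` is a mild
solution with datum `u(t₁)` on a time set containing `0` and `u(t₁) ∈ H¹⁰_df`. -/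
theorem restart_initial {I : Set ℝ} (hv : IsMildSolutionFor F (u t₁) I v) (h0 : (0 : ℝ) ∈ I)
    (hut₁ : MemH10df (u t₁)) : v 0 = u t₁ :=
  eq_of_forall_pairing_eq (hv.1 0 h0) hut₁ fun _ hw => hv.initial h0 hw

/-- **The concatenation takes values in `H¹⁰_df`** on `[0, t₁ + τ)`. -/
theorem memH10df_glue (ht₁T : t₁ < T) (hu : IsMildSolutionFor F a (Ico 0 T) u)
    (hv : IsMildSolutionFor F (u t₁) (Icc 0 τ) v) (h₁ : ∀ t, t ≤ t₁ → g t = u t)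
    (h₂ : ∀ t, t₁ < t → g t = v (t - t₁)) :
    ∀ t ∈ Ico 0 (t₁ + τ), MemH10df (g t) := by
  intro t ht
  by_cases hle : t ≤ t₁
  · rw [h₁ t hle]
    exact hu.1 t ⟨ht.1, hle.trans_lt ht₁T⟩
  · have hlt : t₁ < t := not_le.1 hle
    rw [h₂ t hlt]
    exact hv.1 (t - t₁) ⟨(sub_pos.2 hlt).le, by linarith [ht.2]⟩

/-- **`H¹⁰`-continuity of the concatenation** on `[0, t₁ + τ)`: away from `t₁` the concatenation is
locally `u`, resp. a time translate of `v`; at the junction the left limit is `u`'s and the right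
limit is `v(· - t₁) → v(0) = u(t₁)`. -/
theorem continuousInH10On_glue (ht₁ : 0 ≤ t₁) (ht₁T : t₁ < T) (hτ : 0 < τ)
    (hu : IsMildSolutionFor F a (Ico 0 T) u) (hv : IsMildSolutionFor F (u t₁) (Icc 0 τ) v)
    (h₁ : ∀ t, t ≤ t₁ → g t = u t) (h₂ : ∀ t, t₁ < t → g t = v (t - t₁)) :
    ContinuousInH10On (Ico 0 (t₁ + τ)) g := by
  have hv0 : v 0 = u t₁ := restart_initial hv ⟨le_rfl, hτ.le⟩ (hu.1 t₁ ⟨ht₁, ht₁T⟩)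
  intro t₀ ht₀
  rcases lt_trichotomy t₀ t₁ with hlt | heq | hgt
  · -- left of the junction: the concatenation is `u` near `t₀`
    have key : Tendsto (fun t => eFourierSobolevNorm 10 (u t - u t₀)) (𝓝[Ico 0 t₁] t₀) (𝓝 0) :=
      (hu.2.1 t₀ ⟨ht₀.1, hlt.trans ht₁T⟩).mono_left (nhdsWithin_mono _ (Ico_subset_Ico_right ht₁T.le))
    have hset : 𝓝[Ico 0 (t₁ + τ)] t₀ = 𝓝[Ico 0 t₁] t₀ := by
      rw [nhdsWithin_restrict' (Ico 0 (t₁ + τ)) (Iio_mem_nhds hlt)]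
      congr 1
      ext t
      simp only [mem_inter_iff, mem_Ico, mem_Iio]
      constructor
      · rintro ⟨⟨h0, -⟩, h⟩
        exact ⟨h0, h⟩
      · rintro ⟨h0, h⟩
        exact ⟨⟨h0, h.trans_le (le_add_of_nonneg_right hτ.le)⟩, h⟩
    rw [hset]
    refine key.congr' ?_
    filter_upwards [self_mem_nhdsWithin] with t ht
    rw [h₁ t ht.2.le, h₁ t₀ hlt.le]
  · -- at the junction: left limit from `u`, right limit from `v (· - t₁) → v 0 = u t₁`
    rw [heq]
    have hleft : Tendsto (fun t => eFourierSobolevNorm 10 (g t - g t₁)) (𝓝[Icc 0 t₁] t₁) (𝓝 0) := by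
      have key : Tendsto (fun t => eFourierSobolevNorm 10 (u t - u t₁)) (𝓝[Icc 0 t₁] t₁) (𝓝 0) :=
        (hu.2.1 t₁ ⟨ht₁, ht₁T⟩).mono_left (nhdsWithin_mono _ (Icc_subset_Ico_right ht₁T))
      refine key.congr' ?_
      filter_upwards [self_mem_nhdsWithin] with t ht
      rw [h₁ t ht.2, h₁ t₁ le_rfl]
    have hright : Tendsto (fun t => eFourierSobolevNorm 10 (g t - g t₁)) (𝓝[Ioo t₁ (t₁ + τ)] t₁)
        (𝓝 0) := by
      have hmap : Tendsto (fun t => t - t₁) (𝓝[Ioo t₁ (t₁ + τ)] t₁) (𝓝[Icc 0 τ] 0) := by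
        refine tendsto_nhdsWithin_iff.2 ⟨?_, ?_⟩
        · have h : Tendsto (fun t => t - t₁) (𝓝 t₁) (𝓝 (t₁ - t₁)) :=
            (continuous_id.sub continuous_const).tendsto t₁
          rw [sub_self] at h
          exact h.mono_left nhdsWithin_le_nhds
        · filter_upwards [self_mem_nhdsWithin] with t ht
          exact ⟨(sub_pos.2 ht.1).le, by linarith [ht.2]⟩
      have key := (hv.2.1 0 ⟨le_rfl, hτ.le⟩).comp hmap
      refine key.congr' ?_
      filter_upwards [self_mem_nhdsWithin] with t ht
      simp only [Function.comp_apply]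
      rw [h₂ t ht.1, h₁ t₁ le_rfl, hv0]
    have hunion : Ico 0 (t₁ + τ) ⊆ Icc 0 t₁ ∪ Ioo t₁ (t₁ + τ) := fun t ht =>
      (le_or_gt t t₁).elim (fun h => Or.inl ⟨ht.1, h⟩) fun h => Or.inr ⟨h, ht.2⟩
    refine (tendsto_sup.2 ⟨hleft, hright⟩).mono_left ?_
    rw [← nhdsWithin_union]
    exact nhdsWithin_mono _ hunion
  · -- right of the junction: the concatenation is `v (· - t₁)` near `t₀`
    have hs₀ : t₀ - t₁ ∈ Ioo 0 τ := ⟨sub_pos.2 hgt, by linarith [ht₀.2]⟩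
    have key : Tendsto (fun s => eFourierSobolevNorm 10 (v s - v (t₀ - t₁))) (𝓝 (t₀ - t₁)) (𝓝 0) := by
      have h := hv.2.1 (t₀ - t₁) (Ioo_subset_Icc_self hs₀)
      rwa [nhdsWithin_eq_nhds.2 (Icc_mem_nhds hs₀.1 hs₀.2)] at h
    have key2 : Tendsto (fun t => eFourierSobolevNorm 10 (v (t - t₁) - v (t₀ - t₁))) (𝓝 t₀) (𝓝 0) :=
      key.comp ((continuous_id.sub continuous_const).tendsto t₀)
    refine (key2.mono_left nhdsWithin_le_nhds).congr' ?_
    filter_upwards [mem_nhdsWithin_of_mem_nhds (Ioi_mem_nhds hgt)] with t ht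
    rw [h₂ t ht, h₂ t₀ hgt]

/-- A curve that is `H¹⁰`-continuous with values of finite `H¹⁰` norm on a compact interval is
`H¹⁰`-bounded there, in the `ℝ≥0∞` form used by part II of stub U. -/
theorem exists_H10_le_ofReal {b c : ℝ} (hg : ContinuousInH10On (Icc b c) g)
    (hfin : ∀ t ∈ Icc b c, eFourierSobolevNorm 10 (g t) < ⊤) :
    ∃ M : ℝ, ∀ t ∈ Icc b c, eFourierSobolevNorm 10 (g t) ≤ ENNReal.ofReal M := by
  obtain ⟨M, hM⟩ := hg.exists_bound hfin
  refine ⟨M, fun t ht => ?_⟩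
  rw [← ENNReal.ofReal_toReal (hfin t ht).ne]
  exact ENNReal.ofReal_le_ofReal (hM t ht)

/-- **The Duhamel identity of the concatenation** (for the averaged form of an arbitrary averaging
datum `𝒜`): for `t ∈ [0, t₁ + τ)` and `w ∈ H¹⁰_df`,
`⟨g(t), w⟩ = ⟨e^{tΔ}a, w⟩ + ∫₀ᵗ ⟨B̃(g(s),g(s)), e^{(t-s)Δ} w⟩ ds`. For `t ≤ t₁` this is `u`'s
identity; for `t > t₁` it is `v`'s identity at `t - t₁`, in which `⟨e^{(t-t₁)Δ}u(t₁), w⟩ =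
⟨u(t₁), e^{(t-t₁)Δ}w⟩` is expanded by `u`'s identity at `t₁` tested against `e^{(t-t₁)Δ}w ∈ H¹⁰_df`,
the heat semigroup law recombines the propagators, and the two time integrals over `[0,t₁]` and
(after translation) `[t₁,t]` are joined, using the interval integrability of the integrand that the
`H¹⁰`-continuity of the concatenation provides. -/
theorem duhamel_glue (𝒜 : AveragingDatum) (ht₁ : 0 ≤ t₁) (ht₁T : t₁ < T) (hτ : 0 < τ)
    (hu : IsMildSolutionFor 𝒜.form a (Ico 0 T) u)
    (hv : IsMildSolutionFor 𝒜.form (u t₁) (Icc 0 τ) v)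
    (h₁ : ∀ t, t ≤ t₁ → g t = u t) (h₂ : ∀ t, t₁ < t → g t = v (t - t₁)) :
    ∀ t ∈ Ico 0 (t₁ + τ), ∀ w, MemH10df w →
      pairing (g t) w =
        pairing (heat t a) w + ∫ s in (0 : ℝ)..t, 𝒜.form (g s) (g s) (heat (t - s) w) := by
  intro t ht w hw
  by_cases hle : t ≤ t₁
  · -- before the restart time the concatenation is `u` on all of `[0, t]`
    rw [h₁ t hle, hu.2.2 t ⟨ht.1, hle.trans_lt ht₁T⟩ w hw]
    congr 1
    refine intervalIntegral.integral_congr fun s hs => ?_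
    rw [uIcc_of_le ht.1] at hs
    rw [h₁ s (hs.2.trans hle)]
  · have hlt : t₁ < t := not_le.1 hle
    have hs0 : 0 < t - t₁ := sub_pos.2 hlt
    have hsτ : t - t₁ < τ := by linarith [ht.2]
    have hv0 : v 0 = u t₁ := restart_initial hv ⟨le_rfl, hτ.le⟩ (hu.1 t₁ ⟨ht₁, ht₁T⟩)
    -- interval integrability of the Duhamel integrand of the concatenation on `[0, t]`
    have hcont : ContinuousInH10On (Icc 0 t) g :=
      (continuousInH10On_glue ht₁ ht₁T hτ hu hv h₁ h₂).mono (Icc_subset_Ico_right ht.2)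
    have hfin : ∀ s ∈ Icc 0 t, eFourierSobolevNorm 10 (g s) < ⊤ := fun s hs =>
      (memH10df_glue ht₁T hu hv h₁ h₂ s ⟨hs.1, hs.2.trans_lt ht.2⟩).1
    obtain ⟨M, hM⟩ := exists_H10_le_ofReal hcont hfin
    have hint₁ : IntervalIntegrable (fun s => 𝒜.form (g s) (g s) (heat (t - s) w)) volume 0 t₁ :=
      U.intervalIntegrable_form_heat 𝒜 hcont hM w t
        (by rw [uIcc_of_le ht₁]; exact Icc_subset_Icc_right hlt.le)
    have hint₂ : IntervalIntegrable (fun s => 𝒜.form (g s) (g s) (heat (t - s) w)) volume t₁ t :=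
      U.intervalIntegrable_form_heat 𝒜 hcont hM w t
        (by rw [uIcc_of_le hlt.le]; exact Icc_subset_Icc_left ht₁)
    -- `v`'s identity at `t - t₁` and `u`'s identity at `t₁` tested against `e^{(t-t₁)Δ} w`
    have ev := hv.2.2 (t - t₁) ⟨hs0.le, hsτ.le⟩ w hw
    have eu := hu.2.2 t₁ ⟨ht₁, ht₁T⟩ (heat (t - t₁) w) (hw.heat _)
    -- the free terms recombine by the semigroup law
    have efree : pairing (heat t₁ a) (heat (t - t₁) w) = pairing (heat t a) w := by
      rw [← pairing_heat_left, heat_heat hs0.le ht₁, sub_add_cancel]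
    -- `u`'s Duhamel integral is the concatenation's integral over `[0, t₁]`
    have eI₁ : ∫ s in (0 : ℝ)..t₁, 𝒜.form (u s) (u s) (heat (t₁ - s) (heat (t - t₁) w)) =
        ∫ s in (0 : ℝ)..t₁, 𝒜.form (g s) (g s) (heat (t - s) w) := by
      refine intervalIntegral.integral_congr fun s hs => ?_
      rw [uIcc_of_le ht₁] at hs
      rw [h₁ s hs.2, heat_heat (sub_nonneg.2 hs.2) hs0.le, show t₁ - s + (t - t₁) = t - s by ring]
    -- `v`'s Duhamel integral is the concatenation's integral over `[t₁, t]` (translation)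
    have eI₂ : ∫ s in (0 : ℝ)..(t - t₁), 𝒜.form (v s) (v s) (heat (t - t₁ - s) w) =
        ∫ s in t₁..t, 𝒜.form (g s) (g s) (heat (t - s) w) := by
      have h := intervalIntegral.integral_comp_sub_right
        (fun s => 𝒜.form (v s) (v s) (heat (t - t₁ - s) w)) t₁ (a := t₁) (b := t)
      rw [sub_self] at h
      rw [← h]
      refine intervalIntegral.integral_congr fun s hs => ?_
      rw [uIcc_of_le hlt.le] at hs
      have hgs : g s = v (s - t₁) := by
        rcases eq_or_lt_of_le hs.1 with h' | h'
        · rw [← h', h₁ t₁ le_rfl, sub_self, hv0]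
        · exact h₂ s h'
      rw [hgs, show t - t₁ - (s - t₁) = t - s by ring]
    rw [h₂ t hlt, ev, pairing_heat_left (t - t₁) (u t₁) w, eu, efree, eI₁, eI₂, add_assoc,
      intervalIntegral.integral_add_adjacent_intervals hint₁ hint₂]

end Glue

end Summit.NavierStokesRegularity.NavierStokesRegularity.Theorems.PerpetualPumpThesis.G

namespace Summit.NavierStokesRegularity.NavierStokesRegularity.Theorems.PerpetualPumpThesis

open Literature.Analysis.FluidPDE Literature.Analysis.FluidPDE.Tao2016
open Literature.Analysis.FunctionSpaces

/-- **Stub G (`restart`): semigroup gluing of a restarted mild solution.** For every averaging datum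
`𝒜`: if `u` is a mild `H¹⁰_df` solution of the averaged equation from `a` on `[0,T)` and `v` is a
mild solution on `[0,τ]` from the restarted datum `u(t₁)` (`0 ≤ t₁ < T`, `τ > 0`), then the
concatenation `t ↦ u(t)` for `t ≤ t₁`, `t ↦ v(t - t₁)` for `t > t₁`, is a mild solution from `a`
on `[0, t₁ + τ)` (Tao 2016, §1.1 after (1.15): the standard `H¹⁰` local theory). -/
theorem stub_restart :
    ∀ 𝒜 : AveragingDatum, ∀ (a : L2C) (T t₁ τ : ℝ) (u v : ℝ → L2C),
      0 ≤ t₁ → t₁ < T → 0 < τ →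
      IsMildSolutionFor 𝒜.form a (Ico 0 T) u →
      IsMildSolutionFor 𝒜.form (u t₁) (Icc 0 τ) v →
      IsMildSolutionFor 𝒜.form a (Ico 0 (t₁ + τ)) (fun t => if t ≤ t₁ then u t else v (t - t₁)) := by
  intro 𝒜 a T t₁ τ u v ht₁ ht₁T hτ hu hv
  have h₁ : ∀ t, t ≤ t₁ → (fun t => if t ≤ t₁ then u t else v (t - t₁)) t = u t :=
    fun t ht => if_pos ht
  have h₂ : ∀ t, t₁ < t → (fun t => if t ≤ t₁ then u t else v (t - t₁)) t = v (t - t₁) :=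
    fun t ht => if_neg (not_le.2 ht)
  exact ⟨G.memH10df_glue ht₁T hu hv h₁ h₂, G.continuousInH10On_glue ht₁ ht₁T hτ hu hv h₁ h₂,
    G.duhamel_glue 𝒜 ht₁ ht₁T hτ hu hv h₁ h₂⟩

end Summit.NavierStokesRegularity.NavierStokesRegularity.Theorems.PerpetualPumpThesis
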